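import Mathlib
import Summits.NavierStokesRegularity.NavierStokesRegularity.Theorems.EulerZoomLiouvillePowerGaugeEulerLiouvilleAnchoredBudgetFloorPath
import HarnessLib

/-!
# Crux `EulerZoomLiouville.PowerGaugeEulerLiouville` (stmt-NavierStokesRegularity-19832), line `anchored-budget`, stub C1 — part 2:
# ANCHORED FLOOR TRANSPORT — the Crippa–De Lellis no-escape bound and the avatar of a floor blob

Route №10 `EulerZoomLiouville` (NavierStokesRegularity), crux E.  Line `anchored-budget` (ideator ns-idea-11 g4;
`Cruxes/PowerGaugeEulerLiouville/Lines/anchored_budget.lean`, keyed text fff720633dd1c61f), stub **C1 `stub_anchoredFloorTransport`** (seat ns-sfl-p1 g3;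
C2 is ns-ezl-w2 g2's).  On a flow-owning classical far past `(−∞,T₁)` with a stretching budget `(K, Λ)`, `K ≥ 0`, FLOOR BLOBS ARE ANCHORED: a
late blob `B = B(x₀,δ) ⊆ B(0,a/2)` at time `t₀ < T₁` on which `|ω(t₀)| ≥ w` has at every earlier time `t₁` and for every EVICTION BUDGET `Φ`
(`∫_E |u(s)| ≤ Φ(s)` for measurable `E ⊆ B(0,a)` with `|E| ≤ |B|`) a measurable avatar `T ⊆ B(0,a)` with `|B| ≤ |T| + (∫Φ)/(a/2)` carrying the floor
`|ω(t₁)|² ≥ w² e^{−2∫Λ} ((−t₀)/(−t₁))^{2K}`.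

Proof (part 1 = `…AnchoredBudgetFloorPath`: the Grönwall floor along trajectories and the displacement of an escaping label).  Here:
* the ESCAPE SET `Esc = {ξ ∈ B : sup_{[t₁,t₀]} ‖X_s ξ‖ ≥ a}` is measurable (the sup over the compact time interval is continuous in the label,
  `IsCompact.continuous_sSup`); `(a/2)|Esc| ≤ ∫_{Esc}∫_{[t₁,t₀]} 1_{B(0,a)}(X_sξ)|u(s,X_sξ)| ≤ ∫_{[t₁,t₀]} ∫_{X_s(B) ∩ B(0,a)} |u(s,y)| dy ds ≤ ∫Φ`
  (Tonelli; change of variables `lintegral_image_eq_lintegral_abs_det_fderiv_mul` with `det DX_s = 1`, `KelvinPhysical.det_fderiv_evolutionMap_eq_one_of_mem`;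
  the eviction budget at the measurable sets `E_s = X_s(B) ∩ B(0,a)`, `|E_s| ≤ |X_s(B)| = |B|`);
* the AVATAR `T = X_{t₁}(B ∖ Esc) ⊆ B(0,a)`, measurable with `|T| = |B ∖ Esc|` (`KelvinPhysical.volume_image_evolutionMap`), carries the floor by
  `sq_norm_curl_floor_along`.

* `anchoredFloorTransport` — **C1 = `Sig.stub_anchoredFloorTransport` with `IsAnchorablePast`, `HasStretchingBudget`, `AnchoredFloorBlobs` UNFOLDED VERBATIM
  (text fff720633dd1c61f)**.

WHAT THIS IS NOT: not NS regularity, not the crux E (19832 OPEN) — ONE registered line stub `--supports` stmt-19832; pure kinematics of a classical flow.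
[cite: CrippaDeLellis2008, §2–3 (no-escape / compressibility estimates); MajdaBertozziCUP2002, §1.3, §1.6 (1.51), §2.5 (2.115)–(2.117)]
-/

noncomputable section

-- flat `Theorems/<Route><Decl>…` files of one crux share the namespace of the crux (tree convention)
set_option linter.dupNamespace false

open MeasureTheory Set Filter Topology Metric Function InnerProductSpace
open scoped RealInnerProductSpace NNReal ENNReal

namespace Summit.NavierStokesRegularity.NavierStokesRegularity.Theorems.PowerGaugeEulerLiouville.AnchoredBudget

open Literature.Analysis Literature.Analysis.FluidPDE Literature.Analysis.ODE

variable {u : ℝ → EuclideanSpace ℝ (Fin 3) → EuclideanSpace ℝ (Fin 3)} {p : ℝ → EuclideanSpace ℝ (Fin 3) → ℝ}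

/-! ### Change of variables under the volume-preserving trajectory maps (Lebesgue integral form) -/

/-- `∫⁻_{ξ ∈ A} g(X_t ξ) dξ = ∫⁻_{X_t A} g` for the two-time maps of a classical Euler flow (`det DX_t = 1`), Lebesgue-integral form of
`KelvinPhysical.setIntegral_image_evolutionMap`. [cite: MajdaBertozziCUP2002, §1.3 Prop. 1.4] -/
theorem setLIntegral_comp_evolutionMap_eq {S : Set ℝ} (hcl : IsClassicalEulerSolutionOn S 0 u p) (hL : ODE.IsUniformlyLipschitzOn u S)
    (hS : Convex ℝ S) (hU : UniqueDiffOn ℝ S) {t₀ t : ℝ} (ht₀ : t₀ ∈ S) (ht : t ∈ S) {A : Set (EuclideanSpace ℝ (Fin 3))} (hAm : MeasurableSet A)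
    (g : EuclideanSpace ℝ (Fin 3) → ℝ≥0∞) :
    ∫⁻ ξ in A, g (ODE.evolutionMap u t₀ t ξ) = ∫⁻ y in ODE.evolutionMap u t₀ t '' A, g y := by
  have hdiff : ∀ x ∈ A, HasFDerivWithinAt (ODE.evolutionMap u t₀ t) (fderiv ℝ (ODE.evolutionMap u t₀ t) x) A x := fun x _ =>
    (((hL.contDiff_evolutionMap hS hU le_top hcl.smooth_velocity ht₀ ht).differentiable (by simp)) x).hasFDerivAt.hasFDerivWithinAt
  have hinj : InjOn (ODE.evolutionMap u t₀ t) A := (hL.bijective_evolutionMap hS ht₀ ht).injective.injOn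
  rw [lintegral_image_eq_lintegral_abs_det_fderiv_mul volume hAm hdiff hinj]
  refine setLIntegral_congr_fun hAm fun x _ => ?_
  rw [KelvinPhysical.det_fderiv_evolutionMap_eq_one_of_mem hcl hL hS hU ht₀ ht x]
  simp

/-! ### The anchored avatar -/

/-- **ANCHORED FLOOR TRANSPORT (core statement).**  Classical Euler flow on `(−∞,0)` owning its flow (gradient bounded on compact time sets), a
stretching budget `⟪∇u ω,ω⟫ ≤ (K/(−τ) + Λ)|ω|²` on `(−∞,T₁)` with `Λ` integrable there; a blob `B(x₀,δ)`, `‖x₀‖ + δ ≤ a/2`, with `|ω(t₀)| ≥ w` at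
`t₀ < T₁ ≤ 0`; an earlier time `t₁ < t₀` and an eviction budget `Φ ≥ 0` on `[t₁,t₀]`.  Then there is a measurable `T ⊆ B(0,a)` with
`|B| ≤ |T| + (∫_{[t₁,t₀]}Φ)/(a/2)` on which `w² e^{−2∫_{(t₁,t₀)}Λ}((−t₀)/(−t₁))^{2K} ≤ |ω(t₁)|²`.
[cite: CrippaDeLellis2008, §2–3; MajdaBertozziCUP2002, §1.6 (1.51), §2.5] -/
theorem exists_anchored_avatar (hcl : IsClassicalEulerSolutionOn (Iio 0) 0 u p) {T₁ : ℝ} (hT₁ : T₁ ≤ 0)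
    (hgrad : ∀ t₁ t₂ : ℝ, t₁ < t₂ → t₂ < 0 → ∃ L : ℝ, ∀ τ ∈ Icc t₁ t₂, ∀ x : EuclideanSpace ℝ (Fin 3), ‖fderiv ℝ (u τ) x‖ ≤ L)
    {K : ℝ} {Λ : ℝ → ℝ} (hΛi : IntegrableOn Λ (Iio T₁))
    (hS : ∀ τ : ℝ, τ < T₁ → ∀ x : EuclideanSpace ℝ (Fin 3),
      ⟪fderiv ℝ (u τ) x (curl (u τ) x), curl (u τ) x⟫ ≤ (K / (-τ) + Λ τ) * ‖curl (u τ) x‖ ^ 2)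
    {t₀ : ℝ} (ht₀ : t₀ < T₁) {x₀ : EuclideanSpace ℝ (Fin 3)} {δ w a : ℝ} {Φ : ℝ → ℝ} (ha : 0 < a) (hxa : ‖x₀‖ + δ ≤ a / 2)
    (hw : ∀ x ∈ ball x₀ δ, w ≤ ‖curl (u t₀) x‖) {t₁ : ℝ} (h10 : t₁ < t₀) (hΦi : IntegrableOn Φ (Icc t₁ t₀)) (hΦ0 : ∀ s ∈ Icc t₁ t₀, 0 ≤ Φ s)
    (hΦE : ∀ s ∈ Icc t₁ t₀, ∀ E : Set (EuclideanSpace ℝ (Fin 3)), MeasurableSet E → E ⊆ ball (0 : EuclideanSpace ℝ (Fin 3)) a →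
      volume E ≤ volume (ball x₀ δ) → ∫⁻ x in E, ‖u s x‖ₑ ≤ ENNReal.ofReal (Φ s))
    (hw0 : 0 ≤ w) :
    ∃ T : Set (EuclideanSpace ℝ (Fin 3)), MeasurableSet T ∧ T ⊆ ball (0 : EuclideanSpace ℝ (Fin 3)) a ∧
      volume (ball x₀ δ) ≤ volume T + ENNReal.ofReal ((∫ s in Icc t₁ t₀, Φ s) / (a / 2)) ∧
      ∀ x ∈ T, w ^ 2 * Real.exp (-(2 * ∫ s in Ioo t₁ t₀, Λ s)) * ((-t₀) / (-t₁)) ^ (2 * K) ≤ ‖curl (u t₁) x‖ ^ 2 := by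
  have ht₀0 : t₀ < 0 := lt_of_lt_of_le ht₀ hT₁
  have ht₁0 : t₁ < 0 := h10.trans ht₀0
  have hSc : Convex ℝ (Iio (0 : ℝ)) := convex_Iio 0
  have hU : UniqueDiffOn ℝ (Iio (0 : ℝ)) := uniqueDiffOn_Iio 0
  have ht₀S : t₀ ∈ Iio (0 : ℝ) := ht₀0
  have ht₁S : t₁ ∈ Iio (0 : ℝ) := ht₁0
  have hIcc : Icc t₁ t₀ ⊆ Iio (0 : ℝ) := fun s hs => lt_of_le_of_lt hs.2 ht₀0
  have hL : ODE.IsUniformlyLipschitzOn u (Iio 0) := isUniformlyLipschitzOn_of_gradientBound hcl hgrad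
  set X : ℝ → EuclideanSpace ℝ (Fin 3) → EuclideanSpace ℝ (Fin 3) := ODE.evolutionMap u t₀ with hX
  set B : Set (EuclideanSpace ℝ (Fin 3)) := ball x₀ δ with hB
  have hBm : MeasurableSet B := measurableSet_ball
  -- joint continuity of the flow, with the time clamped to `[t₁,t₀]`
  set π : ℝ → ℝ := fun s => max t₁ (min s t₀) with hπ
  have hπc : Continuous π := continuous_const.max (continuous_id.min continuous_const)
  have hπI : ∀ s, π s ∈ Icc t₁ t₀ := fun s => ⟨le_max_left _ _, max_le h10.le (min_le_right _ _)⟩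
  have hπid : ∀ s ∈ Icc t₁ t₀, π s = s := fun s hs => by
    simp only [hπ]; rw [min_eq_left hs.2, max_eq_right hs.1]
  have hXj : ContinuousOn (fun q : ℝ × EuclideanSpace ℝ (Fin 3) => X q.1 q.2) (Iio 0 ×ˢ univ) :=
    (hL.contDiffOn_evolutionMap_uncurry hSc hU (n := 1) le_rfl (hcl.smooth_velocity.of_le (by exact_mod_cast le_top)) ht₀S).continuousOn
  have hXπ : Continuous fun q : EuclideanSpace ℝ (Fin 3) × ℝ => X (π q.2) q.1 := by
    have h2 : Continuous fun q : EuclideanSpace ℝ (Fin 3) × ℝ => ((π q.2, q.1) : ℝ × EuclideanSpace ℝ (Fin 3)) :=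
      (hπc.comp continuous_snd).prodMk continuous_fst
    exact hXj.comp_continuous h2 fun q => mk_mem_prod (hIcc (hπI q.2)) (mem_univ _)
  have huπ : Continuous fun q : EuclideanSpace ℝ (Fin 3) × ℝ => u (π q.2) (X (π q.2) q.1) := by
    have h2 : Continuous fun q : EuclideanSpace ℝ (Fin 3) × ℝ => ((π q.2, X (π q.2) q.1) : ℝ × EuclideanSpace ℝ (Fin 3)) :=
      (hπc.comp continuous_snd).prodMk hXπ
    exact hcl.smooth_velocity.continuousOn.comp_continuous h2 fun q => mk_mem_prod (hIcc (hπI q.2)) (mem_univ _)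
  -- the sup of `‖X_s ξ‖` over `[t₁,t₀]` is continuous in the label
  set N : EuclideanSpace ℝ (Fin 3) → ℝ := fun ξ => sSup ((fun s => ‖X (π s) ξ‖) '' Icc t₁ t₀) with hN
  have hNc : Continuous N := isCompact_Icc.continuous_sSup (f := fun ξ s => ‖X (π s) ξ‖) hXπ.norm
  have hK'c : ∀ ξ, IsCompact ((fun s => ‖X (π s) ξ‖) '' Icc t₁ t₀) := fun ξ =>
    isCompact_Icc.image ((hXπ.comp (Continuous.prodMk_right ξ)).norm)
  have hK'ne : ∀ ξ, ((fun s => ‖X (π s) ξ‖) '' Icc t₁ t₀).Nonempty := fun ξ => (nonempty_Icc.2 h10.le).image _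
  have hleN : ∀ ξ, ∀ s ∈ Icc t₁ t₀, ‖X s ξ‖ ≤ N ξ := fun ξ s hs => by
    have h := le_csSup (hK'c ξ).bddAbove (mem_image_of_mem (fun s => ‖X (π s) ξ‖) hs)
    rwa [hπid s hs] at h
  have hNesc : ∀ ξ, a ≤ N ξ → ∃ s ∈ Icc t₁ t₀, a ≤ ‖X s ξ‖ := fun ξ hξ => by
    obtain ⟨s, hs, hseq⟩ := (hK'c ξ).sSup_mem (hK'ne ξ)
    refine ⟨s, hs, ?_⟩
    rw [← hπid s hs]
    simp only at hseq
    rw [hseq]; exact hξ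
  -- escape set and good set
  set Esc : Set (EuclideanSpace ℝ (Fin 3)) := B ∩ N ⁻¹' Ici a with hEsc
  set G : Set (EuclideanSpace ℝ (Fin 3)) := B ∩ N ⁻¹' Iio a with hG
  have hEscm : MeasurableSet Esc := hBm.inter (measurableSet_Ici.preimage hNc.measurable)
  have hGm : MeasurableSet G := hBm.inter (measurableSet_Iio.preimage hNc.measurable)
  have hBsub : B ⊆ G ∪ Esc := fun ξ hξ => by
    by_cases h : N ξ < a
    · exact Or.inl ⟨hξ, h⟩
    · exact Or.inr ⟨hξ, not_lt.1 h⟩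
  -- the avatar
  refine ⟨X t₁ '' G, hL.measurableSet_image_evolutionMap hSc ht₀S ht₁S hGm, ?_, ?_, ?_⟩
  · rintro y ⟨ξ, hξ, rfl⟩
    exact mem_ball_zero_iff.2 (lt_of_le_of_lt (hleN ξ t₁ (left_mem_Icc.2 h10.le)) hξ.2)
  · -- `|B| ≤ |G| + |Esc| = |T| + |Esc|` and the no-escape bound `|Esc| ≤ (∫Φ)/(a/2)`
    have hvolT : volume (X t₁ '' G) = volume G := KelvinPhysical.volume_image_evolutionMap hcl hL hSc hU ht₀S ht₁S hGm
    have hEscle : ENNReal.ofReal (a / 2) * volume Esc ≤ ENNReal.ofReal (∫ s in Icc t₁ t₀, Φ s) := by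
      -- the integrand, with clamped time (measurable on the whole product)
      set F : EuclideanSpace ℝ (Fin 3) → ℝ → ℝ≥0∞ := fun ξ s =>
        (ball (0 : EuclideanSpace ℝ (Fin 3)) a).indicator (fun y => ‖u (π s) y‖ₑ) (X (π s) ξ) with hF
      have hFm : Measurable (uncurry F) := by
        have e : uncurry F = Set.indicator ((fun q : EuclideanSpace ℝ (Fin 3) × ℝ => X (π q.2) q.1) ⁻¹' ball 0 a)
            (fun q => ‖u (π q.2) (X (π q.2) q.1)‖ₑ) := by
          funext q
          rfl
        rw [e]
        exact huπ.measurable.enorm.indicator (measurableSet_ball.preimage hXπ.measurable)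
      -- pointwise on `Esc`: `a/2 ≤ ∫ F ξ`
      have hpt : ∀ ξ ∈ Esc, ENNReal.ofReal (a / 2) ≤ ∫⁻ s in Icc t₁ t₀, F ξ s := by
        intro ξ hξ
        have hξn : ‖ξ‖ < a / 2 := by
          have h1 : ‖ξ‖ ≤ ‖ξ - x₀‖ + ‖x₀‖ := norm_le_norm_sub_add ξ x₀
          have h2 : ‖ξ - x₀‖ < δ := mem_ball_iff_norm.1 hξ.1
          linarith
        have h := half_le_lintegral_of_escape hcl hL ht₀0 hξn (hNesc ξ hξ.2)
        refine h.trans (le_of_eq (setLIntegral_congr_fun measurableSet_Icc fun s hs => ?_))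
        simp only [hF, hπid s hs, hX]
      calc ENNReal.ofReal (a / 2) * volume Esc = ∫⁻ _ in Esc, ENNReal.ofReal (a / 2) := (setLIntegral_const _ _).symm
        _ ≤ ∫⁻ ξ in Esc, ∫⁻ s in Icc t₁ t₀, F ξ s :=
            lintegral_mono_ae ((ae_restrict_iff' hEscm).2 (Eventually.of_forall hpt))
        _ ≤ ∫⁻ ξ in B, ∫⁻ s in Icc t₁ t₀, F ξ s := lintegral_mono_set inter_subset_left
        _ = ∫⁻ s in Icc t₁ t₀, ∫⁻ ξ in B, F ξ s := lintegral_lintegral_swap hFm.aemeasurable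
        _ ≤ ∫⁻ s in Icc t₁ t₀, ENNReal.ofReal (Φ s) := by
            refine lintegral_mono_ae ((ae_restrict_iff' measurableSet_Icc).2 (Eventually.of_forall fun s hs => ?_))
            have hsS : s ∈ Iio (0 : ℝ) := hIcc hs
            have himm : MeasurableSet (X s '' B) := hL.measurableSet_image_evolutionMap hSc ht₀S hsS hBm
            have hvol : volume (X s '' B) = volume B := KelvinPhysical.volume_image_evolutionMap hcl hL hSc hU ht₀S hsS hBm
            calc ∫⁻ ξ in B, F ξ s = ∫⁻ ξ in B, (ball (0 : EuclideanSpace ℝ (Fin 3)) a).indicator (fun y => ‖u s y‖ₑ) (X s ξ) := by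
                  simp only [hF, hπid s hs]
              _ = ∫⁻ y in X s '' B, (ball (0 : EuclideanSpace ℝ (Fin 3)) a).indicator (fun y => ‖u s y‖ₑ) y :=
                  setLIntegral_comp_evolutionMap_eq hcl hL hSc hU ht₀S hsS hBm _
              _ = ∫⁻ y in ball (0 : EuclideanSpace ℝ (Fin 3)) a ∩ X s '' B, ‖u s y‖ₑ := by
                  rw [lintegral_indicator measurableSet_ball, Measure.restrict_restrict measurableSet_ball]
              _ ≤ ENNReal.ofReal (Φ s) :=
                  hΦE s hs _ (measurableSet_ball.inter himm) inter_subset_left ((measure_mono inter_subset_right).trans hvol.le)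
        _ = ENNReal.ofReal (∫ s in Icc t₁ t₀, Φ s) :=
            (ofReal_integral_eq_lintegral_ofReal hΦi ((ae_restrict_iff' measurableSet_Icc).2 (Eventually.of_forall hΦ0))).symm
    have ha2 : 0 < a / 2 := by linarith
    have hEscle' : volume Esc ≤ ENNReal.ofReal ((∫ s in Icc t₁ t₀, Φ s) / (a / 2)) := by
      rw [ENNReal.ofReal_div_of_pos ha2, ENNReal.le_div_iff_mul_le (Or.inl ((ENNReal.ofReal_pos.2 ha2).ne'))
        (Or.inl ENNReal.ofReal_ne_top), mul_comm]
      exact hEscle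
    calc volume (ball x₀ δ) = volume B := rfl
      _ ≤ volume (G ∪ Esc) := measure_mono hBsub
      _ ≤ volume G + volume Esc := measure_union_le _ _
      _ ≤ volume (X t₁ '' G) + ENNReal.ofReal ((∫ s in Icc t₁ t₀, Φ s) / (a / 2)) := by rw [hvolT]; gcongr
  · -- the floor on the avatar
    rintro y ⟨ξ, hξ, rfl⟩
    obtain ⟨Lg, hLg⟩ := hgrad t₁ t₀ h10 ht₀0
    have hfl := sq_norm_curl_floor_along hcl hL h10 ht₀0 hLg (K := K)
      (hΛi.mono_set fun s hs => lt_of_le_of_lt hs.2 ht₀) (fun τ hτ x => hS τ (lt_of_le_of_lt hτ.2 ht₀) x) ξ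
    refine le_trans ?_ hfl
    have hwξ : w ^ 2 ≤ ‖curl (u t₀) ξ‖ ^ 2 := pow_le_pow_left₀ hw0 (hw ξ hξ.1) 2
    have hnn : 0 ≤ Real.exp (-(2 * ∫ s in Ioo t₁ t₀, Λ s)) * ((-t₀) / (-t₁)) ^ (2 * K) :=
      mul_nonneg (Real.exp_pos _).le (Real.rpow_nonneg (div_nonneg (by linarith) (by linarith)) _)
    calc w ^ 2 * Real.exp (-(2 * ∫ s in Ioo t₁ t₀, Λ s)) * ((-t₀) / (-t₁)) ^ (2 * K)
        = w ^ 2 * (Real.exp (-(2 * ∫ s in Ioo t₁ t₀, Λ s)) * ((-t₀) / (-t₁)) ^ (2 * K)) := by ring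
      _ ≤ ‖curl (u t₀) ξ‖ ^ 2 * (Real.exp (-(2 * ∫ s in Ioo t₁ t₀, Λ s)) * ((-t₀) / (-t₁)) ^ (2 * K)) :=
          mul_le_mul_of_nonneg_right hwξ hnn
      _ = ‖curl (u t₀) ξ‖ ^ 2 * Real.exp (-(2 * ∫ s in Ioo t₁ t₀, Λ s)) * ((-t₀) / (-t₁)) ^ (2 * K) := by ring

/-! ### C1, verbatim -/

/-- **C1 `stub_anchoredFloorTransport` (line `anchored-budget`, text fff720633dd1c61f) — `Sig.stub_anchoredFloorTransport` with `IsAnchorablePast`,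
`HasStretchingBudget`, `AnchoredFloorBlobs` UNFOLDED VERBATIM: on a flow-owning classical far past with a stretching budget `(K, Λ)`, `K ≥ 0`, floor
blobs are ANCHORED.**  (`exists_anchored_avatar`.)  Not NS regularity, not the crux E (19832 OPEN).
[cite: CrippaDeLellis2008, §2–3; MajdaBertozziCUP2002, §1.6 (1.51), §2.5 (2.115)–(2.117)] -/
theorem anchoredFloorTransport :
    ∀ (u : ℝ → EuclideanSpace ℝ (Fin 3) → EuclideanSpace ℝ (Fin 3)) (p : ℝ → EuclideanSpace ℝ (Fin 3) → ℝ) (T₁ K : ℝ) (Λ : ℝ → ℝ),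
      (IsClassicalEulerSolutionOn (Set.Iio 0) 0 u p ∧ T₁ ≤ 0 ∧
          (∀ t₁ t₂ : ℝ, t₁ < t₂ → t₂ < 0 → ∃ L : ℝ, ∀ τ ∈ Set.Icc t₁ t₂, ∀ x : EuclideanSpace ℝ (Fin 3), ‖fderiv ℝ (u τ) x‖ ≤ L)) →
        0 ≤ K →
          (IntegrableOn Λ (Set.Iio T₁) ∧ (∀ τ : ℝ, 0 ≤ Λ τ) ∧
              ∀ τ : ℝ, τ < T₁ → ∀ x : EuclideanSpace ℝ (Fin 3),
                ⟪fderiv ℝ (u τ) x (curl (u τ) x), curl (u τ) x⟫ ≤ (K / (-τ) + Λ τ) * ‖curl (u τ) x‖ ^ 2) →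
            ∀ t₀ : ℝ, t₀ < T₁ → ∀ (x₀ : EuclideanSpace ℝ (Fin 3)) (δ w a : ℝ) (Φ : ℝ → ℝ), 0 < δ → 0 ≤ w → 0 < a → ‖x₀‖ + δ ≤ a / 2 →
              (∀ x ∈ ball x₀ δ, w ≤ ‖curl (u t₀) x‖) →
                ∀ t₁ : ℝ, t₁ < t₀ → IntegrableOn Φ (Set.Icc t₁ t₀) → (∀ s ∈ Set.Icc t₁ t₀, 0 ≤ Φ s) →
                  (∀ s ∈ Set.Icc t₁ t₀, ∀ E : Set (EuclideanSpace ℝ (Fin 3)), MeasurableSet E →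
                      E ⊆ ball (0 : EuclideanSpace ℝ (Fin 3)) a → volume E ≤ volume (ball x₀ δ) →
                        ∫⁻ x in E, ‖u s x‖ₑ ≤ ENNReal.ofReal (Φ s)) →
                    ∃ T : Set (EuclideanSpace ℝ (Fin 3)), MeasurableSet T ∧ T ⊆ ball (0 : EuclideanSpace ℝ (Fin 3)) a ∧
                      volume (ball x₀ δ) ≤ volume T + ENNReal.ofReal ((∫ s in Set.Icc t₁ t₀, Φ s) / (a / 2)) ∧
                        ∀ x ∈ T, w ^ 2 * Real.exp (-(2 * ∫ s in Set.Ioo t₁ t₀, Λ s)) * ((-t₀) / (-t₁)) ^ (2 * K) ≤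
                          ‖curl (u t₁) x‖ ^ 2 := by
  intro u p T₁ K Λ hP _hK hSB t₀ ht₀ x₀ δ w a Φ _hδ hw0 ha hxa hw t₁ h10 hΦi hΦ0 hΦE
  exact exists_anchored_avatar hP.1 hP.2.1 hP.2.2 hSB.1 hSB.2.2 ht₀ ha hxa hw h10 hΦi hΦ0 hΦE hw0

end Summit.NavierStokesRegularity.NavierStokesRegularity.Theorems.PowerGaugeEulerLiouville.AnchoredBudget

end
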